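import Summits.CriticalPhenomena.PercolationContinuityZ3.Theorems.PercNearOneGluingNoHeavyLowerTailSunflowerGrainModel
import Summits.CriticalPhenomena.PercolationContinuityZ3.Theorems.PercNearOneGluingNoHeavyLowerTailSunflowerChainGraph

/-!
# `NoHeavyLowerTail` (crux stmt-CriticalPhenomena-4575), abstract sunflower cubic: THE COST GAME OF A BIPARTITE GRAPH CORE IS A
# GRAIN MODEL (memo FINDING-PAR-prove1-g46 §3) — Part 1: the clause family and the identification

Support file (seat `prim-ineq-prove-1` gen 46; `--supports stmt-CriticalPhenomena-4575`).  No `sorry`, no named facts.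
SETTING.  `Γ` a graph all of whose edges join the disjoint vertex blocks `L` and `R` (`IsBip`); `nb B ⊆ R` the neighbourhood of
`B ⊆ L`; for `D ⊆ R`, `Mset D = {l ∈ L : nb {l} ⊆ D} ∪ (R \ D)` is an independent set, and every independent subset of `L ∪ R`
lies in some `Mset (nb B)`; the CLAUSE FAMILY `clauses = {(L ∪ R) \ Mset (nb B) : B ⊆ L}` therefore satisfies the hypotheses of
`SafeCalc.gsafe_of_cover` for the edge-core `edgeCore Γ` (`mset_not_mem_edgeCore`, `exists_clause_subset`).
GRAIN DICTIONARY.  Atoms = subsets `B ⊆ L` with masses `P(ω ∩ L = B)`, grains `nb B`, coordinates `R` present (= CLOSED) with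
probability `1 - p r`; for an allowed sub-family `𝒰` the grain family `rhat 𝒰` consists of the nonempty atom sets `S` whose joint
neighbourhood `nb (⋃ S)` is `C ∩ R` for a forbidden clause `C ∉ 𝒰`.
* `clauses_allowed_iff`, **`famIn_clauses_eq_G`**: `famIn p (L ∪ R) clauses 𝒰 = Grain.G m q nb R (rhat 𝒰)` — the hitting probabilities of the clause family
  ARE the grain game (conditioning on the two blocks, `BEx_union`).
Part 2 (`…SunflowerBipartiteCover`) derives COVER, graded safety, safety and `Safe(B ⊔ Γ')` from THEOREM 2 (`Grain.G_le_FR'`).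
-/

noncomputable section

namespace Summit.CriticalPhenomena.PercolationContinuityZ3.Theorems.SunflowerPartition

namespace BipCover

open Finset SafeCalc
open TwoGenCore (wmiss)

variable {ι : Type*} [Fintype ι] [DecidableEq ι] (Γ : SimpleGraph ι) [DecidableRel Γ.Adj] (L R : Finset ι)

/-- Bipartiteness with respect to the blocks `L`, `R`: disjoint blocks, every edge joins them. [this work] -/
structure IsBip : Prop where
  /-- The two blocks are disjoint. -/
  disj : Disjoint L R
  /-- Every edge joins `L` and `R`. -/
  adj : ∀ u v, Γ.Adj u v → (u ∈ L ∧ v ∈ R) ∨ (u ∈ R ∧ v ∈ L)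

/-- The `R`-neighbourhood of a set of (left) vertices. [this work] -/
def nb (B : Finset ι) : Finset ι := R.filter fun r => ∃ l ∈ B, Γ.Adj l r

/-- The independent set attached to `D ⊆ R`: left vertices seeing only `D`, plus `R \ D`. [this work] -/
def mset (D : Finset ι) : Finset ι := (L.filter fun l => nb Γ R {l} ⊆ D) ∪ (R \ D)

/-- The clause attached to `B ⊆ L`: the complement in `L ∪ R` of `mset (nb B)`. [this work] -/
def clauseOf (B : Finset ι) : Finset ι := (L ∪ R) \ mset Γ L R (nb Γ R B)

/-- The clause family `{clauseOf B : B ⊆ L}`. [this work] -/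
def clauses : Finset (Finset ι) := L.powerset.image (clauseOf Γ L R)

variable {Γ L R}

/-! ## Neighbourhoods and the independent sets `mset` -/

omit [Fintype ι] [DecidableEq ι] in
/-- `nb B ⊆ R`. [this work] -/
theorem nb_subset (B : Finset ι) : nb Γ R B ⊆ R := filter_subset _ _

omit [Fintype ι] [DecidableEq ι] in
/-- Membership in `nb`. [this work] -/
theorem mem_nb {B : Finset ι} {r : ι} : r ∈ nb Γ R B ↔ r ∈ R ∧ ∃ l ∈ B, Γ.Adj l r := mem_filter

omit [Fintype ι] [DecidableEq ι] in
/-- `nb` is monotone. [this work] -/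
theorem nb_mono {B B' : Finset ι} (h : B ⊆ B') : nb Γ R B ⊆ nb Γ R B' := fun r hr => by
  obtain ⟨hrR, l, hl, hadj⟩ := mem_nb.mp hr
  exact mem_nb.mpr ⟨hrR, l, h hl, hadj⟩

omit [Fintype ι] [DecidableEq ι] in
/-- `nb B ⊆ D ↔ ∀ l ∈ B, nb {l} ⊆ D`. [this work] -/
theorem nb_subset_iff {B D : Finset ι} : nb Γ R B ⊆ D ↔ ∀ l ∈ B, nb Γ R {l} ⊆ D := by
  constructor
  · intro h l hl
    exact (nb_mono (singleton_subset_iff.mpr hl)).trans h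
  · intro h r hr
    obtain ⟨hrR, l, hl, hadj⟩ := mem_nb.mp hr
    exact h l hl (mem_nb.mpr ⟨hrR, l, mem_singleton_self l, hadj⟩)

omit [Fintype ι] in
/-- `nb (B ∪ B') = nb B ∪ nb B'`. [this work] -/
theorem nb_union (B B' : Finset ι) : nb Γ R (B ∪ B') = nb Γ R B ∪ nb Γ R B' := by
  ext r
  simp only [mem_nb, mem_union]
  constructor
  · rintro ⟨hr, l, hl | hl, hadj⟩
    · exact Or.inl ⟨hr, l, hl, hadj⟩
    · exact Or.inr ⟨hr, l, hl, hadj⟩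
  · rintro (⟨hr, l, hl, hadj⟩ | ⟨hr, l, hl, hadj⟩)
    · exact ⟨hr, l, Or.inl hl, hadj⟩
    · exact ⟨hr, l, Or.inr hl, hadj⟩

omit [Fintype ι] in
/-- `nb (S.sup f) = S.sup (nb ∘ f)`. [this work] -/
theorem nb_sup {κ : Type*} (S : Finset κ) (f : κ → Finset ι) :
    nb Γ R (S.sup f) = S.sup fun k => nb Γ R (f k) := by
  classical
  induction S using Finset.induction_on with
  | empty => ext r; simp [mem_nb]
  | insert k S hk ih => rw [sup_insert, sup_insert, sup_eq_union, nb_union, ih]; rfl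

omit [Fintype ι] in
/-- `mset D ⊆ L ∪ R`. [this work] -/
theorem mset_subset (D : Finset ι) : mset Γ L R D ⊆ L ∪ R :=
  union_subset_union (filter_subset _ _) sdiff_subset

omit [Fintype ι] in
/-- `mset D` is an independent set of `Γ`. [this work] -/
theorem mset_not_mem_edgeCore (hb : IsBip Γ L R) (D : Finset ι) :
    ((mset Γ L R D : Finset ι) : Set ι) ∉ edgeCore Γ := by
  rintro ⟨u, v, hadj, hu, hv⟩
  rw [Finset.mem_coe] at hu hv
  -- reduce to `u ∈ L`, `v ∈ R`
  have key : ∀ u v, Γ.Adj u v → u ∈ L → v ∈ R → u ∈ mset Γ L R D → v ∈ mset Γ L R D → False := by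
    intro u v hadj huL hvR hu hv
    have huL' : u ∉ R := fun h => disjoint_left.mp hb.disj huL h
    have hvL' : v ∉ L := fun h => disjoint_left.mp hb.disj h hvR
    rw [mset, mem_union, mem_filter, mem_sdiff] at hu hv
    rcases hu with ⟨-, hu⟩ | ⟨hu, -⟩
    · rcases hv with ⟨hv, -⟩ | ⟨-, hvD⟩
      · exact hvL' hv
      · exact hvD (hu (mem_nb.mpr ⟨hvR, u, mem_singleton_self u, hadj⟩))
    · exact huL' hu
  rcases hb.adj u v hadj with ⟨huL, hvR⟩ | ⟨huR, hvL⟩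
  · exact key u v hadj huL hvR hu hv
  · exact key v u hadj.symm hvL huR hv hu

omit [Fintype ι] in
/-- `(L ∪ R) \ clauseOf B = mset (nb B)`. [this work] -/
theorem sdiff_clauseOf (B : Finset ι) : (L ∪ R) \ clauseOf Γ L R B = mset Γ L R (nb Γ R B) := by
  rw [clauseOf, sdiff_sdiff_right_self, inf_eq_inter, inter_eq_right]
  exact mset_subset _

omit [Fintype ι] in
/-- For `T ⊆ L ∪ R`:  `clauseOf B ⊆ T ↔ (L ∪ R) \ T ⊆ mset (nb B)`. [this work] -/
theorem clauseOf_subset_iff (B T : Finset ι) :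
    clauseOf Γ L R B ⊆ T ↔ (L ∪ R) \ T ⊆ mset Γ L R (nb Γ R B) := by
  rw [clauseOf]
  constructor
  · intro h x hx
    rw [mem_sdiff] at hx
    by_contra hxM
    exact hx.2 (h (mem_sdiff.mpr ⟨hx.1, hxM⟩))
  · intro h x hx
    rw [mem_sdiff] at hx
    by_contra hxT
    exact hx.2 (h (mem_sdiff.mpr ⟨hx.1, hxT⟩))

omit [Fintype ι] in
/-- The combinatorial form of `clauseOf B' ⊆ T₁ ∪ T₂` (`T₁ ⊆ L`, `T₂ ⊆ R`): `nb (L \ T₁) ⊆ nb B' ⊆ T₂`. [this work] -/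
theorem clauseOf_subset_union_iff (hb : IsBip Γ L R) (B' T₁ T₂ : Finset ι) (hT₁ : T₁ ⊆ L) (hT₂ : T₂ ⊆ R) :
    clauseOf Γ L R B' ⊆ T₁ ∪ T₂ ↔ nb Γ R (L \ T₁) ⊆ nb Γ R B' ∧ nb Γ R B' ⊆ T₂ := by
  rw [clauseOf_subset_iff B' (T₁ ∪ T₂)]
  have hdecomp : ∀ x, x ∈ (L ∪ R) \ (T₁ ∪ T₂) ↔ (x ∈ L ∧ x ∉ T₁) ∨ (x ∈ R ∧ x ∉ T₂) := by
    intro x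
    simp only [mem_sdiff, mem_union, not_or]
    constructor
    · rintro ⟨hx | hx, h1, h2⟩
      · exact Or.inl ⟨hx, h1⟩
      · exact Or.inr ⟨hx, h2⟩
    · rintro (⟨hx, h1⟩ | ⟨hx, h2⟩)
      · exact ⟨Or.inl hx, h1, fun h => disjoint_left.mp hb.disj hx (hT₂ h)⟩
      · exact ⟨Or.inr hx, fun h => disjoint_left.mp hb.disj (hT₁ h) hx, h2⟩
  constructor
  · intro h
    constructor
    · rw [nb_subset_iff]
      intro l hl
      rw [mem_sdiff] at hl
      have := h ((hdecomp l).mpr (Or.inl hl))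
      rw [mset, mem_union, mem_filter, mem_sdiff] at this
      rcases this with ⟨-, h'⟩ | ⟨hlR, -⟩
      · exact h'
      · exact absurd hlR (fun hlR => disjoint_left.mp hb.disj hl.1 hlR)
    · intro r hr
      have hrR : r ∈ R := nb_subset _ hr
      by_contra hrT
      have := h ((hdecomp r).mpr (Or.inr ⟨hrR, hrT⟩))
      rw [mset, mem_union, mem_filter, mem_sdiff] at this
      rcases this with ⟨hrL, -⟩ | ⟨-, hrD⟩
      · exact disjoint_left.mp hb.disj hrL hrR
      · exact hrD hr
  · rintro ⟨h1, h2⟩ x hx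
    rcases (hdecomp x).mp hx with ⟨hxL, hxT⟩ | ⟨hxR, hxT⟩
    · rw [mset, mem_union, mem_filter]
      refine Or.inl ⟨hxL, (nb_mono ?_).trans h1⟩
      exact singleton_subset_iff.mpr (mem_sdiff.mpr ⟨hxL, hxT⟩)
    · rw [mset, mem_union, mem_sdiff]
      exact Or.inr ⟨hxR, fun hxD => hxT (h2 hxD)⟩

omit [Fintype ι] in
/-- Every `T ⊆ L ∪ R` whose complement is independent contains a clause. [this work] -/
theorem exists_clause_subset (hb : IsBip Γ L R) (T : Finset ι) (hT : T ⊆ L ∪ R)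
    (hind : (((L ∪ R) \ T : Finset ι) : Set ι) ∉ edgeCore Γ) : ∃ C ∈ clauses Γ L R, C ⊆ T := by
  refine ⟨clauseOf Γ L R (L \ T), mem_image.mpr ⟨L \ T, mem_powerset.mpr sdiff_subset, rfl⟩, ?_⟩
  have hT' : (T ∩ L) ∪ (T ∩ R) = T := by
    rw [← inter_union_distrib_left, inter_eq_left.mpr hT]
  have hLT : L \ (T ∩ L) = L \ T := sdiff_inter_self_right _ _
  have key : clauseOf Γ L R (L \ T) ⊆ (T ∩ L) ∪ (T ∩ R) := by
    refine (clauseOf_subset_union_iff hb _ _ _ inter_subset_right inter_subset_right).mpr ⟨by rw [hLT], fun r hr => ?_⟩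
    obtain ⟨hrR, l, hl, hadj⟩ := mem_nb.mp hr
    rw [mem_sdiff] at hl
    by_contra hrT
    apply hind
    refine ⟨l, r, hadj, ?_, ?_⟩
    · rw [Finset.mem_coe, mem_sdiff, mem_union]; exact ⟨Or.inl hl.1, hl.2⟩
    · rw [Finset.mem_coe, mem_sdiff, mem_union]
      exact ⟨Or.inr hrR, fun h => hrT (mem_inter.mpr ⟨h, hrR⟩)⟩
  rwa [hT'] at key

/-! ## The grain dictionary -/

variable (Γ L R) (p : ι → unitInterval)

/-- Atoms: the subsets of `L`. [this work] -/
abbrev Atom := ↥L.powerset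

/-- Mass of the atom `B`: `P(ω ∩ L = B)`. [this work] -/
def mass (B : Atom L) : ℝ := wmiss p L (L \ B.1)

/-- Coordinate probabilities: `q r = 1 - p r` (the coordinate is CLOSED). [this work] -/
def qq (r : ι) : ℝ := 1 - (p r : ℝ)

/-- Grains: `N B = nb B`. [this work] -/
def grain (B : Atom L) : Finset ι := nb Γ R B.1

/-- Joint neighbourhood of a set of atoms. [this work] -/
def nbU (S : Finset (Atom L)) : Finset ι := S.sup fun B => nb Γ R B.1

/-- The grain family of an allowed sub-family `𝒰`: nonempty atom sets whose joint neighbourhood is that of a forbidden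
clause. [this work] -/
def rhat (𝒰 : Finset (Finset ι)) : Finset (Finset (Atom L)) :=
  univ.filter fun S => S.Nonempty ∧ ∃ B ∈ L.powerset, clauseOf Γ L R B ∉ 𝒰 ∧ nbU Γ L R S = nb Γ R B

variable {Γ L R}

omit [Fintype ι] in
/-- `wt (1 - p) R W = wmiss p R W`. [this work] -/
theorem wt_qq (W : Finset ι) : Grain.wt (qq p) R W = wmiss p R W := by
  unfold Grain.wt qq wmiss
  congr 1
  exact prod_congr rfl fun r _ => by ring

omit [Fintype ι] in
/-- Coverage through `rhat 𝒰` in combinatorial form. [this work] -/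
theorem cov_rhat_iff (𝒰 : Finset (Finset ι)) (B : Atom L) (W : Finset ι) :
    (∃ S ∈ rhat Γ L R 𝒰, B ∈ S ∧ ∀ j ∈ S, grain Γ L R j ∩ R ⊆ W) ↔
      ∃ B' ∈ L.powerset, clauseOf Γ L R B' ∉ 𝒰 ∧ nb Γ R B.1 ⊆ nb Γ R B' ∧ nb Γ R B' ⊆ W := by
  constructor
  · rintro ⟨S, hS, hBS, hN⟩
    obtain ⟨-, -, B', hB', hC, hnb⟩ := mem_filter.mp hS
    have hsub : nb Γ R B.1 ⊆ nbU Γ L R S := Finset.le_sup (f := fun B : Atom L => nb Γ R B.1) hBS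
    refine ⟨B', hB', hC, hnb ▸ hsub, ?_⟩
    rw [← hnb, nbU]
    exact Finset.sup_le fun j hj => by
      have := hN j hj
      rwa [grain, inter_eq_left.mpr (nb_subset _)] at this
  · rintro ⟨B', hB', hC, h1, h2⟩
    refine ⟨{B, ⟨B', hB'⟩}, mem_filter.mpr ⟨mem_univ _, insert_nonempty _ _, B', hB', hC, ?_⟩, mem_insert_self _ _,
      fun j hj => ?_⟩
    · rw [nbU, sup_insert, sup_singleton, sup_eq_union]
      exact union_eq_right.mpr h1
    · rw [grain, inter_eq_left.mpr (nb_subset _)]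
      rcases mem_insert.mp hj with rfl | hj
      · exact h1.trans h2
      · rw [mem_singleton] at hj; rw [hj]; exact h2

omit [Fintype ι] in
/-- The clause-family event "every clause inside `T₁ ∪ T₂` is allowed" is the complement of grain coverage. [this work] -/
theorem clauses_allowed_iff (hb : IsBip Γ L R) (𝒰 : Finset (Finset ι)) (T₁ T₂ : Finset ι) (hT₁ : T₁ ⊆ L)
    (hT₂ : T₂ ⊆ R) :
    (∀ C ∈ clauses Γ L R, C ⊆ T₁ ∪ T₂ → C ∈ 𝒰) ↔
      ¬ ∃ S ∈ rhat Γ L R 𝒰, (⟨L \ T₁, mem_powerset.mpr sdiff_subset⟩ : Atom L) ∈ S ∧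
        ∀ j ∈ S, grain Γ L R j ∩ R ⊆ T₂ := by
  rw [cov_rhat_iff, not_exists]
  constructor
  · rintro h B' ⟨hB', hC, h1, h2⟩
    exact hC (h _ (mem_image.mpr ⟨B', hB', rfl⟩) ((clauseOf_subset_union_iff hb B' T₁ T₂ hT₁ hT₂).mpr ⟨h1, h2⟩))
  · intro h C hC hCT
    obtain ⟨B', hB', rfl⟩ := mem_image.mp hC
    by_contra hCU
    exact h B' ⟨hB', hCU, (clauseOf_subset_union_iff hb B' T₁ T₂ hT₁ hT₂).mp hCT⟩

/-- **THE IDENTIFICATION.**  The hitting probabilities of the clause family are the grain game: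
`famIn p (L ∪ R) clauses 𝒰 = G mass (1 - p) grain R (rhat 𝒰)`. [this work] -/
theorem famIn_clauses_eq_G (hb : IsBip Γ L R) (𝒰 : Finset (Finset ι)) :
    famIn p (L ∪ R) (clauses Γ L R) 𝒰 = Grain.G (mass L p) (qq p) (grain Γ L R) R (rhat Γ L R 𝒰) := by
  unfold famIn Grain.G Grain.hit
  rw [BEx_union p hb.disj]
  unfold BEx
  -- rewrite the atom sum as a sum over `T₁ ⊆ L` via `B = L \ T₁`
  have hatom : ∑ B : Atom L, mass L p B * ∑ W ∈ R.powerset, Grain.wt (qq p) R W *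
      Grain.cov (grain Γ L R) R (rhat Γ L R 𝒰) B W =
      ∑ T₁ ∈ L.powerset, wmiss p L T₁ * ∑ W ∈ R.powerset, wmiss p R W *
        Grain.cov (grain Γ L R) R (rhat Γ L R 𝒰) ⟨L \ T₁, mem_powerset.mpr sdiff_subset⟩ W := by
    rw [← Finset.sum_coe_sort L.powerset]
    refine Finset.sum_nbij' (fun B : Atom L => ⟨L \ B.1, mem_powerset.mpr sdiff_subset⟩)
      (fun T : Atom L => ⟨L \ T.1, mem_powerset.mpr sdiff_subset⟩) (fun _ _ => mem_univ _) (fun _ _ => mem_univ _)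
      (fun B _ => ?_) (fun T _ => ?_) (fun B _ => ?_)
    · exact Subtype.ext (Finset.sdiff_sdiff_eq_self (mem_powerset.mp B.2))
    · exact Subtype.ext (Finset.sdiff_sdiff_eq_self (mem_powerset.mp T.2))
    · simp only [mass]
      congr 1
      refine sum_congr rfl fun W _ => ?_
      rw [wt_qq]
      congr 2
      exact Subtype.ext (Finset.sdiff_sdiff_eq_self (mem_powerset.mp B.2)).symm
  rw [hatom, eq_sub_iff_add_eq, ← sum_add_distrib]
  calc _ = ∑ T₁ ∈ L.powerset, wmiss p L T₁ := sum_congr rfl fun T₁ hT₁ => ?_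
    _ = 1 := sum_wmiss p L
  beta_reduce
  rw [← mul_add, ← sum_add_distrib]
  conv_rhs => rw [← mul_one (wmiss p L T₁)]
  congr 1
  calc _ = ∑ T₂ ∈ R.powerset, wmiss p R T₂ := sum_congr rfl fun T₂ hT₂ => ?_
    _ = 1 := sum_wmiss p R
  rw [← mul_add]
  conv_rhs => rw [← mul_one (wmiss p R T₂)]
  congr 1
  unfold Grain.cov
  have key := clauses_allowed_iff hb 𝒰 T₁ T₂ (mem_powerset.mp hT₁) (mem_powerset.mp hT₂)
  by_cases h1 : (∀ C ∈ clauses Γ L R, C ⊆ T₁ ∪ T₂ → C ∈ 𝒰) <;>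
  by_cases h2 : (∃ S ∈ rhat Γ L R 𝒰, (⟨L \ T₁, mem_powerset.mpr sdiff_subset⟩ : Atom L) ∈ S ∧
      ∀ j ∈ S, grain Γ L R j ∩ R ⊆ T₂)
  · exact absurd h2 (key.mp h1)
  · rw [if_pos h1, if_neg h2]; norm_num
  · rw [if_neg h1, if_pos h2]; norm_num
  · exact absurd (key.mpr h2) h1

end BipCover

end Summit.CriticalPhenomena.PercolationContinuityZ3.Theorems.SunflowerPartition
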